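import Summits.ResolutionOfSingularities.ResolutionOfSingularities.Theorems.WeightedInvariantLocalWeightedDropTupleDropPlane
import Summits.ResolutionOfSingularities.ResolutionOfSingularities.Theorems.WeightedInvariantLocalWeightedDropMultiplicityLift

/-!
# `LocalWeightedDrop`: the tuple game in `m` variables is won from a radical count with free smooth centres and a monomial phase
# (dimension- and predicate-generic assembly)

[OURS · L1 W4.3 · chain w43, engine crux `LocalWeightedDrop` stmt-ResolutionOfSingularities-8899; res-type-088 for strategist
res-L1-w43-strat-1's line `tame-four-tuple-drop` (`L/res-L1-w43-strat-1/tame_four_tuple_drop_v1.lean`, stub (G3)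
`stub_tupleDropSpace`), written so that (G3) is the instance `m + 1 = 3`, `P = SpaceIsNC`, and the landed plane assembly
`stub_tupleDropPlane` (…Theorems.WeightedInvariantLocalWeightedDropTupleDropPlane) is the instance `m + 1 = 2`,
`P = PlaneGerm.IsNC` with the point blow-up as the count's move.]  NOT a statement of any manuscript; the game (`TupleGame.Drop`) is the
programme's own.

HYPOTHESES (for an ARBITRARY predicate `P` on germs in `m + 1 ≥ 1` variables, "the support is a normal crossing" in the applications):
(i)–(iii) a RADICAL COUNT `ν : k⟦x⟧ → ℕ` WITH FREE SMOOTH CENTRES — (i) `ν b = 0 ↔ P b` for `b ≠ 0`; (ii) radical monotonicity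
`b ∣ d^(N+1) → ν b ≤ ν d` (`d ≠ 0`); (iii) from every `b ≠ 0` with `¬ P b` a move — a legal coordinate change `Φ` and weights
`w ∈ {0,1}^(m+1) ∖ 0` — such that at every exceptional point `c ≠ 0` (with `c_i = 0` on the weight-`0` slots) and every factorisation
`b∘Φ(chart_{w,c}) = s^A · G`, `s ∤ G`, some live slot `i` (`c_i ≠ 0`) has `ν (s · G|_{y_i' = 0}) < ν b`; and a MONOMIAL PHASE —
for every `e` an ordinal rank `μ` uniformly bounded by some `β` which, from a non-zero bad tuple whose support product satisfies
`P`, drops after some move at every non-zero bad successor while keeping `P` of the support product.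
CONCLUSION: `TupleGame.Drop k (m + 1) e` for every `e`.

Proof (that of `stub_tupleDropPlane`, with the point blow-up replaced by the count's own move): `κ a := β · ν (prodSupport a) + μ a`.
If `P (prodSupport a)` use the monomial phase's move (`ν` is `0` before and after by (i), `μ` drops).  Otherwise take the move
`(Φ, w)` of (iii) for `b := prodSupport a`: from the factorisation data `a_j∘Φ(chart) = s^{D_j} · G_j`, `s ∤ G_j` of the non-zero
entries, `b∘Φ(chart) = s^{Σ D_j} · Π G_j` with `s ∤ Π G_j` (`s` is prime), so (iii) gives a live slot `i` with
`ν (s · (Π G_j)|_{y_i' = 0}) < ν b`; the slice is a ring map fixing `s` and `(Π G_j)| ≠ 0` by the TAME SLICE at a live slot of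
weight `1` (`stub_unitRoot`, `stub_tameSliceKappa`, `stub_sliceCyl`, all dimension- and weight-generic in the tree), so the new
support product divides a power of the non-zero `s · (Π G_j)|` and (ii) bounds its count; `μ < β` is absorbed lexicographically.

* `tupleDrop_of_count_of_monomialPhase` — the assembly, every field, every number `m + 1` of variables, every `P`.
* `tupleDropThree_of_count_of_monomialPhase` — the same at the literal `Fin 3` (so (G3) `stub_tupleDropSpace k hrad hmono` is
  `fun ⟨ν, h₁, h₂, h₃⟩ ↦ tupleDropThree_of_count_of_monomialPhase SpaceIsNC ν h₁ h₂ h₃ hmono` once the line's defs are in the tree).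
-/

set_option linter.dupNamespace false -- mandated namespace of this single-conjunct summit

namespace Summit.ResolutionOfSingularities.ResolutionOfSingularities.Theorems

open Literature.AlgebraicGeometry.Resolution

namespace TupleDropAssembly

open MvPowerSeries

variable {k : Type} [Field k] {m e : ℕ}

/-- Lexicographic comparison of `β·n + x` with `x < β`, first component. [OURS · folklore] -/
theorem mul_add_lt_of_lt {n n' : ℕ} {β x : Ordinal.{0}} (y : Ordinal.{0}) (hx : x < β) (h : n < n') :
    β * (n : Ordinal.{0}) + x < β * (n' : Ordinal.{0}) + y :=
  calc β * (n : Ordinal.{0}) + x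
      < β * (n : Ordinal.{0}) + β := (add_lt_add_iff_left _).mpr hx
    _ = β * ((n + 1 : ℕ) : Ordinal.{0}) := by rw [Nat.cast_succ, mul_add_one]
    _ ≤ β * (n' : Ordinal.{0}) := mul_le_mul_right (by exact_mod_cast h) _
    _ ≤ _ := le_self_add

/-! ### The slice `y_i' ↦ 0` as a ring map fixing `s` (any number of variables) -/

/-- The slice is multiplicative over finite products. [OURS · folklore] -/
theorem slice_prod (i : Fin m) (f : Fin (e + 1) → MvPowerSeries (Fin (m + 1)) k) :
    TupleGame.slice i (∏ j, f j) = ∏ j, TupleGame.slice i (f j) := by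
  unfold TupleGame.slice
  rw [← coe_substAlgHom (CobordantChartPlaneSlice.hasSubst_slice (R := k) i), map_prod]

/-- THE SLICE OF AN `s`-SATURATED TRANSFORM AT A LIVE SLOT IS NON-ZERO (the tame slice, weights `≤ 1`): in the
factorisation `F(chart_{w,c}) = sᴬ · G`, `s ∤ G`, of a move with weights `w ∈ {0,1}^m` (convention `c_i = 0` where
`w_i = 0`), `G|_{y_i' = 0} ≠ 0` whenever `c_i ≠ 0`, because `G` is a unit times a coordinate change of the cylinder over
that slice (`stub_tameSliceKappa`, `stub_sliceCyl`, `stub_unitRoot` with the root order `w_i = 1`). [OURS · folklore] -/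
theorem slice_ne_zero {n : ℕ} (F : MvPowerSeries (Fin n) k) (w : Fin n → ℕ) (c : Fin n → k)
    (hc : ∀ i, w i = 0 → c i = 0) (hw1 : ∀ i, w i ≤ 1) (A : ℕ) (G : MvPowerSeries (Fin (n + 1)) k)
    (hfac : subst (CobordantChart.chart w c) F = X 0 ^ A * G) (hG : ¬ X 0 ∣ G)
    (i : Fin n) (hci : c i ≠ 0) : TupleGame.slice i G ≠ 0 := by
  intro h0
  have hwi : w i = 1 := by
    have h1 := hw1 i
    have h2 : w i ≠ 0 := fun h => hci (hc i h)
    omega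
  obtain ⟨r, hr1, hrw, hrsupp⟩ := stub_unitRoot k n i.succ (w i) (by rw [hwi, Nat.cast_one]; exact one_ne_zero)
    (c i) hci
  obtain ⟨Φ, u, hΦ0, -, -, hg⟩ := stub_tameSliceKappa k n F w c hc A G hfac i hci r hr1 hrw hrsupp
  have hcyl := stub_sliceCyl k n i G
  have hsl : subst (fun j : Fin (n + 1) => if j = i.succ then (0 : MvPowerSeries (Fin n) k)
      else X (Fin.predAbove i j)) G = 0 := h0
  have hb : HasSubst (fun l : Fin n => (X ((Fin.succ i).succAbove l) : MvPowerSeries (Fin (n + 1)) k)) :=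
    hasSubst_of_constantCoeff_zero fun l => by simp [constantCoeff_X]
  rw [hsl, ← coe_substAlgHom hb, map_zero] at hcyl
  rw [← hcyl, ← coe_substAlgHom (hasSubst_of_constantCoeff_zero hΦ0), map_zero, mul_zero] at hg
  exact hG (hg ▸ dvd_zero _)

/-! ### The count's move applied to a tuple whose support product is not yet good -/

open scoped Classical in
/-- TRANSFORM OF THE SUPPORT PRODUCT under a move `(Φ, w)` and a chart at `c`: with the factorisation data
`a_j∘Φ(chart) = s^{D_j} · G_j` of the non-zero entries, `(prodSupport a)∘Φ(chart) = s^{Σ D_j} · Π G_j`, and `s ∤ Π G_j`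
when `s ∤ G_j` for all `j` (`s` is prime). [OURS · folklore] -/
theorem subst_chart_subst_prodSupport (a : Fin (e + 1) → MvPowerSeries (Fin m) k)
    (Φ : Fin m → MvPowerSeries (Fin m) k) (hΦ0 : ∀ i, constantCoeff (Φ i) = 0)
    (w : Fin m → ℕ) (c : Fin m → k) (hc : ∀ i, w i = 0 → c i = 0)
    (D : Fin (e + 1) → ℕ) (G : Fin (e + 1) → MvPowerSeries (Fin (m + 1)) k)
    (hfac : ∀ j, a j ≠ 0 →
      subst (CobordantChart.chart w c) (subst Φ (a j)) = X 0 ^ D j * G j ∧ ¬ X 0 ∣ G j) :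
    subst (CobordantChart.chart w c) (subst Φ (TupleGame.prodSupport a)) =
      X 0 ^ (∑ j, if a j = 0 then 0 else D j) * ∏ j, (if a j = 0 then 1 else G j) ∧
    ¬ X (0 : Fin (m + 1)) ∣ ∏ j, (if a j = 0 then (1 : MvPowerSeries (Fin (m + 1)) k) else G j) := by
  have hs := CobordantChart.hasSubst_chart w c hc
  have hΦ := hasSubst_of_constantCoeff_zero hΦ0
  constructor
  · unfold TupleGame.prodSupport
    rw [← coe_substAlgHom hΦ, map_prod, ← coe_substAlgHom hs, map_prod, ← Finset.prod_pow_eq_pow_sum,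
      ← Finset.prod_mul_distrib]
    refine Finset.prod_congr rfl fun j _ => ?_
    by_cases hj : a j = 0
    · rw [if_pos hj, if_pos hj, if_pos hj, map_one, map_one, pow_zero, one_mul]
    · rw [if_neg hj, if_neg hj, if_neg hj, coe_substAlgHom, coe_substAlgHom, (hfac j hj).1]
  · intro h
    obtain ⟨j, -, hj⟩ := (MvPowerSeries.prime_X' k (0 : Fin (m + 1))).exists_mem_finset_dvd h
    by_cases hj0 : a j = 0
    · rw [if_pos hj0] at hj
      exact (MvPowerSeries.prime_X' k (0 : Fin (m + 1))).not_dvd_one hj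
    · rw [if_neg hj0] at hj
      exact (hfac j hj0).2 hj

open scoped Classical in
/-- THE NEW SUPPORT PRODUCT DIVIDES A POWER OF THE COUNTED SLICE: the support product of the successor tuple
`(s^{e_j} · G_j)|_{y_i' = 0}` (zero entries dropped) divides `(s · (Π G_j)|_{y_i' = 0})^{Σ e_j + e + 1}`. [OURS · folklore] -/
theorem prodSupport_newTuple_dvd (a : Fin (e + 1) → MvPowerSeries (Fin (m + 1)) k) (D : Fin (e + 1) → ℕ)
    (G : Fin (e + 1) → MvPowerSeries (Fin (m + 1 + 1)) k) (i : Fin (m + 1)) :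
    TupleGame.prodSupport (TupleGame.newTuple a D G i) ∣
      (X 0 * TupleGame.slice i (∏ j, if a j = 0 then (1 : MvPowerSeries (Fin (m + 1 + 1)) k) else G j)) ^
        ((∑ j, (D j - TupleGame.marking e j * TupleGame.floorWeight a D) + e) + 1) := by
  set W := TupleGame.floorWeight a D
  have hT : ∀ j, a j ≠ 0 → X 0 * TupleGame.slice i (G j) ∣
      X 0 * TupleGame.slice i (∏ j, if a j = 0 then (1 : MvPowerSeries (Fin (m + 1 + 1)) k) else G j) := by
    intro j hj
    refine mul_dvd_mul_left _ ?_
    rw [slice_prod]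
    have h := Finset.dvd_prod_of_mem (fun l => TupleGame.slice i (if a l = 0 then (1 : MvPowerSeries (Fin (m + 1 + 1)) k)
      else G l)) (Finset.mem_univ j)
    rwa [if_neg hj] at h
  have hsum : (∑ j, (D j - TupleGame.marking e j * W) + e) + 1 =
      ∑ j : Fin (e + 1), (D j - TupleGame.marking e j * W + 1) := by
    rw [Finset.sum_add_distrib, Finset.sum_const, Finset.card_univ, Fintype.card_fin, smul_eq_mul, mul_one,
      add_assoc]
  rw [hsum, ← Finset.prod_pow_eq_pow_sum]
  unfold TupleGame.prodSupport
  refine Finset.prod_dvd_prod_of_dvd _ _ fun j _ => ?_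
  split_ifs with hnew
  · exact one_dvd _
  · have hj : a j ≠ 0 := by
      intro h
      apply hnew
      unfold TupleGame.newTuple
      rw [if_pos h]
    refine dvd_trans ?_ (pow_dvd_pow_of_dvd (hT j hj) _)
    unfold TupleGame.newTuple
    rw [if_neg hj, MultiplicityLift.slice_X_zero_pow_mul]
    exact ⟨TupleGame.slice i (G j) ^ (D j - TupleGame.marking e j * W) * X 0, by ring⟩

/-- THE COUNT CLAUSE.  For the move `(Φ, w)` that (iii) assigns to `b := prodSupport a` (when `¬ P b`): at every exceptional
point `c ≠ 0` and every factorisation data of the non-zero entries, the live slot `i` provided by (iii) has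
`ν (prodSupport (newTuple a D G i)) < ν (prodSupport a)`. [OURS · folklore] -/
theorem count_clause (ν : MvPowerSeries (Fin (m + 1)) k → ℕ)
    (hν2 : ∀ b d : MvPowerSeries (Fin (m + 1)) k, d ≠ 0 → ∀ N : ℕ, b ∣ d ^ (N + 1) → ν b ≤ ν d)
    (a : Fin (e + 1) → MvPowerSeries (Fin (m + 1)) k)
    (Φ : Fin (m + 1) → MvPowerSeries (Fin (m + 1)) k) (hΦ0 : ∀ i, constantCoeff (Φ i) = 0)
    (w : Fin (m + 1) → ℕ) (hw1 : ∀ i, w i ≤ 1)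
    (hmove : ∀ c : Fin (m + 1) → k, (∀ i, w i = 0 → c i = 0) → c ≠ 0 →
      ∀ (A : ℕ) (G : MvPowerSeries (Fin (m + 1 + 1)) k),
        subst (CobordantChart.chart w c) (subst Φ (TupleGame.prodSupport a)) = X 0 ^ A * G →
        ¬ (X (0 : Fin (m + 1 + 1)) ∣ G) →
        ∃ i : Fin (m + 1), c i ≠ 0 ∧ ν (X 0 * TupleGame.slice i G) < ν (TupleGame.prodSupport a))
    (c : Fin (m + 1) → k) (hc : ∀ i, w i = 0 → c i = 0) (hc0 : c ≠ 0) (D : Fin (e + 1) → ℕ)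
    (G : Fin (e + 1) → MvPowerSeries (Fin (m + 1 + 1)) k)
    (hfac : ∀ j, a j ≠ 0 →
      subst (CobordantChart.chart w c) (subst Φ (a j)) = X 0 ^ D j * G j ∧ ¬ X 0 ∣ G j) :
    ∃ i : Fin (m + 1), c i ≠ 0 ∧
      ν (TupleGame.prodSupport (TupleGame.newTuple a D G i)) < ν (TupleGame.prodSupport a) := by
  classical
  obtain ⟨hprod, hndvd⟩ := subst_chart_subst_prodSupport a Φ hΦ0 w c hc D G hfac
  obtain ⟨i, hci, hlt⟩ := hmove c hc hc0 _ _ hprod hndvd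
  refine ⟨i, hci, lt_of_le_of_lt (hν2 _ _ ?_ _ (prodSupport_newTuple_dvd a D G i)) hlt⟩
  exact mul_ne_zero (MvPowerSeries.prime_X' k (0 : Fin (m + 1))).ne_zero
    (slice_ne_zero _ w c hc hw1 _ _ hprod hndvd i hci)

end TupleDropAssembly

open TupleDropAssembly in
/-- **THE TUPLE GAME IN `m` VARIABLES IS WON from a radical count with free smooth centres and a monomial phase**
(assembly, every field, any number `m + 1 ≥ 1` of variables, every predicate `P`): hypotheses (i)–(iii) on a count `ν` relative to `P` and a monomial
phase relative to `P` with a uniform ordinal bound (see the module docstring) give `TupleGame.Drop k (m + 1) e` for every `e`.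
Rank: `κ a := β · ν (prodSupport a) + μ a`.  Instances: the landed plane assembly (`m + 1 = 2`, `P = PlaneGerm.IsNC`, the point
blow-up as the count's move) and strategist res-L1-w43-strat-1's (G3) `stub_tupleDropSpace` (`m + 1 = 3`, `P = SpaceIsNC`).
[OURS · L1 W4.3] -/
theorem tupleDrop_of_count_of_monomialPhase {k : Type} [Field k] (m : ℕ)
    (P : MvPowerSeries (Fin (m + 1)) k → Prop) (ν : MvPowerSeries (Fin (m + 1)) k → ℕ)
    (hν1 : ∀ b : MvPowerSeries (Fin (m + 1)) k, b ≠ 0 → (ν b = 0 ↔ P b))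
    (hν2 : ∀ b d : MvPowerSeries (Fin (m + 1)) k, d ≠ 0 → ∀ N : ℕ, b ∣ d ^ (N + 1) → ν b ≤ ν d)
    (hν3 : ∀ b : MvPowerSeries (Fin (m + 1)) k, b ≠ 0 → ¬ P b →
      ∃ (Φ : Fin (m + 1) → MvPowerSeries (Fin (m + 1)) k) (w : Fin (m + 1) → ℕ),
        (∀ i, MvPowerSeries.constantCoeff (Φ i) = 0) ∧
        IsUnit (Matrix.det (Matrix.of fun i j => MvPowerSeries.coeff (Finsupp.single j 1) (Φ i))) ∧
        (∀ i, w i ≤ 1) ∧ (∃ i, 0 < w i) ∧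
        ∀ c : Fin (m + 1) → k, (∀ i, w i = 0 → c i = 0) → c ≠ 0 →
          ∀ (A : ℕ) (G : MvPowerSeries (Fin (m + 1 + 1)) k),
            MvPowerSeries.subst (CobordantChart.chart w c) (MvPowerSeries.subst Φ b) = MvPowerSeries.X 0 ^ A * G →
            ¬ (MvPowerSeries.X (0 : Fin (m + 1 + 1)) ∣ G) →
            ∃ i : Fin (m + 1), c i ≠ 0 ∧ ν (MvPowerSeries.X 0 * TupleGame.slice i G) < ν b)
    (hmono : ∀ e : ℕ, ∃ (β : Ordinal.{0}) (μ : (Fin (e + 1) → MvPowerSeries (Fin (m + 1)) k) → Ordinal.{0}),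
      (∀ a, μ a < β) ∧
      ∀ a : Fin (e + 1) → MvPowerSeries (Fin (m + 1)) k, a ≠ 0 → TupleGame.Bad a →
        P (TupleGame.prodSupport a) →
        TupleGame.StepDrop μ (fun b => P (TupleGame.prodSupport b)) a) :
    ∀ e : ℕ, TupleGame.Drop k (m + 1) e := by
  intro e
  obtain ⟨β, μ, hμlt, hμstep⟩ := hmono e
  refine ⟨fun a => β * (ν (TupleGame.prodSupport a) : Ordinal.{0}) + μ a, ?_⟩
  intro a ha hbad
  by_cases hP : P (TupleGame.prodSupport a)
  · -- good support product: the monomial phase's move; `ν` stays `0`, `μ` drops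
    obtain ⟨Φ, w, hΦ0, hdet, hw1, hwpos, hstep⟩ := hμstep a ha hbad hP
    refine ⟨Φ, w, hΦ0, hdet, hw1, hwpos, ?_⟩
    intro c hc hc0 D G hfac
    obtain ⟨i, hci, hi⟩ := hstep c hc hc0 D G hfac
    refine ⟨i, hci, fun hne hbad' => ⟨trivial, ?_⟩⟩
    obtain ⟨hPnew, hμlt'⟩ := hi hne hbad'
    have h1 : ν (TupleGame.prodSupport (TupleGame.newTuple a D G i)) = 0 :=
      (hν1 _ (TupleGame.prodSupport_ne_zero _)).mpr hPnew
    have h2 : ν (TupleGame.prodSupport a) = 0 := (hν1 _ (TupleGame.prodSupport_ne_zero _)).mpr hP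
    dsimp only
    rw [h1, h2]
    exact (add_lt_add_iff_left _).mpr hμlt'
  · -- bad support product: the count's move for `b := prodSupport a`; `ν` drops at every successor
    obtain ⟨Φ, w, hΦ0, hdet, hw1, hwpos, hmove⟩ := hν3 _ (TupleGame.prodSupport_ne_zero a) hP
    refine ⟨Φ, w, hΦ0, hdet, hw1, hwpos, ?_⟩
    intro c hc hc0 D G hfac
    obtain ⟨i, hci, hlt⟩ := count_clause ν hν2 a Φ hΦ0 w hw1 hmove c hc hc0 D G hfac
    exact ⟨i, hci, fun _ _ => ⟨trivial, mul_add_lt_of_lt _ (hμlt _) hlt⟩⟩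


/-- **The three-variable instance, stated at the literal `Fin 3`** (the shape of strategist res-L1-w43-strat-1's (G3)
`stub_tupleDropSpace` with its predicate `SpaceIsNC` generalised to any `P`): a radical count with free smooth centres and a
monomial phase on `k⟦x₀,x₁,x₂⟧` give `TupleGame.Drop k 3 e` for every `e`. [OURS · L1 W4.3] -/
theorem tupleDropThree_of_count_of_monomialPhase {k : Type} [Field k]
    (P : MvPowerSeries (Fin 3) k → Prop) (ν : MvPowerSeries (Fin 3) k → ℕ)
    (hν1 : ∀ b : MvPowerSeries (Fin 3) k, b ≠ 0 → (ν b = 0 ↔ P b))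
    (hν2 : ∀ b d : MvPowerSeries (Fin 3) k, d ≠ 0 → ∀ N : ℕ, b ∣ d ^ (N + 1) → ν b ≤ ν d)
    (hν3 : ∀ b : MvPowerSeries (Fin 3) k, b ≠ 0 → ¬ P b →
      ∃ (Φ : Fin 3 → MvPowerSeries (Fin 3) k) (w : Fin 3 → ℕ),
        (∀ i, MvPowerSeries.constantCoeff (Φ i) = 0) ∧
        IsUnit (Matrix.det (Matrix.of fun i j => MvPowerSeries.coeff (Finsupp.single j 1) (Φ i))) ∧
        (∀ i, w i ≤ 1) ∧ (∃ i, 0 < w i) ∧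
        ∀ c : Fin 3 → k, (∀ i, w i = 0 → c i = 0) → c ≠ 0 →
          ∀ (A : ℕ) (G : MvPowerSeries (Fin (3 + 1)) k),
            MvPowerSeries.subst (CobordantChart.chart w c) (MvPowerSeries.subst Φ b) = MvPowerSeries.X 0 ^ A * G →
            ¬ (MvPowerSeries.X (0 : Fin (3 + 1)) ∣ G) →
            ∃ i : Fin 3, c i ≠ 0 ∧ ν (MvPowerSeries.X 0 * TupleGame.slice i G) < ν b)
    (hmono : ∀ e : ℕ, ∃ (β : Ordinal.{0}) (μ : (Fin (e + 1) → MvPowerSeries (Fin 3) k) → Ordinal.{0}),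
      (∀ a, μ a < β) ∧
      ∀ a : Fin (e + 1) → MvPowerSeries (Fin 3) k, a ≠ 0 → TupleGame.Bad a →
        P (TupleGame.prodSupport a) →
        TupleGame.StepDrop μ (fun b => P (TupleGame.prodSupport b)) a) :
    ∀ e : ℕ, TupleGame.Drop k 3 e :=
  tupleDrop_of_count_of_monomialPhase 2 P ν hν1 hν2 hν3 hmono

end Summit.ResolutionOfSingularities.ResolutionOfSingularities.Theorems
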